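import Literature.NumberTheory.Sieve.FGKMT2018SingularSeriesConvergence
import HarnessLib

/-!
# FGKMT 2018 §7 / Maynard 2016 §8: splitting the singular series at the primes of `W` —
`𝔖_D(𝓛) = (∏_{p ∣ W, p ∤ D} (1 − ω(p)/p)(1 − 1/p)^{-k}) · 𝔖_{WD}(𝓛)` and
`∏_{p ∣ W} (1 − ω(p)/p)(1 − 1/p)^{-k} = φ_ω(W)/W · (W/φ(W))^k`

Source: K. Ford, B. Green, S. Konyagin, J. Maynard, T. Tao, *Long gaps between primes*, J. Amer.
Math. Soc. 31 (2018), (7.6)–(7.8) p. 21 [FordGreenKonyaginMaynardTao2018]; J. Maynard, *Dense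
clusters of primes in subsets*, Compositio Math. 152 (2016), §8 (Lemma 8.1, proof of Lemma 8.6)
and the proof of Proposition 6.1 from Propositions 9.1–9.2 p. 14 («summing over the `φ_ω(W)`
residue classes `v₀ (mod W)`») [Maynard2016DenseClusters].

The sieve weights of [FordGreenKonyaginMaynardTao2018, §7] are normalised with `𝔖_{WB}(𝓛)`
(`W = ∏_{p ≤ 2k², p ∤ B} p`), while Theorem 6 is stated with `𝔖(𝓛) = 𝔖_B(𝓛)`; the passage between
the two is the finite Euler-product identity recorded here (theorems only):

* `singPartial_eq_prod_mul_singPartial_mul`: for all `x`,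
  `𝔖_D(𝓛; x) = (∏_{p ≤ x prime, p ∣ W, p ∤ D} factor) · 𝔖_{WD}(𝓛; x)`;
* `singPartial_eq_primeFactors_prod_mul`: for `x ≥ W ≥ 1` the finite product is over
  `W.primeFactors` (minus the divisors of `D`);
* `singSeriesExcl_eq_prod_mul_singSeriesExcl_mul` (admissible, non-degenerate `𝓛`, `W ≥ 1`):
  `𝔖_D(𝓛) = (∏_{p ∣ W, p ∤ D} factor) · 𝔖_{WD}(𝓛)`, and `singSeriesExcl_eq_of_coprime` when
  `(W, D) = 1`;
* `prod_primeFactors_singFactor_eq` (`W` squarefree):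
  `∏_{p ∣ W} (1 − ω(p)/p)(1 − 1/p)^{-k} = φ_ω(W)/W · (W/φ(W))^k`;
* `singSeriesExcl_eq_phiOmega_mul` — the combination:
  `𝔖_D(𝓛) = φ_ω(W)/W · (W/φ(W))^k · 𝔖_{WD}(𝓛)` for squarefree `W` coprime to `D`.

## References
* [FordGreenKonyaginMaynardTao2018] (7.6)–(7.8) p. 21.
* [Maynard2016DenseClusters] Lemma 8.1 p. 15; proof of Prop. 6.1 p. 14.
-/

noncomputable section

open Finset Filter Topology

namespace Literature.NumberTheory.Sieve.FGKMT2018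

variable {k : ℕ}

/-- **Finite splitting** of the partial products at the prime divisors of `W`:
`𝔖_D(𝓛; x) = (∏_{p ≤ x prime, p ∣ W, p ∤ D} (1 − ω(p)/p)(1 − 1/p)^{-k}) · 𝔖_{WD}(𝓛; x)`
(a prime divides `WD` iff it divides `W` or `D`).
[cite: FordGreenKonyaginMaynardTao2018, (7.6)–(7.7) p. 21] -/
theorem singPartial_eq_prod_mul_singPartial_mul (L : Fin k → ℤ × ℤ) (W D x : ℕ) :
    singPartial L D x =
      (∏ p ∈ (Finset.range (x + 1)).filter (fun p => p.Prime ∧ p ∣ W ∧ ¬ p ∣ D), singFactor L p)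
        * singPartial L (W * D) x := by
  classical
  unfold singPartial
  rw [← Finset.prod_filter_mul_prod_filter_not
    ((Finset.range (x + 1)).filter (fun p => p.Prime ∧ ¬ p ∣ D)) (fun p => p ∣ W)]
  rw [Finset.filter_filter, Finset.filter_filter]
  congr 1
  · refine Finset.prod_congr (Finset.filter_congr fun p _ => ?_) fun _ _ => rfl
    tauto
  · refine Finset.prod_congr (Finset.filter_congr fun p _ => ?_) fun _ _ => rfl
    constructor
    · rintro ⟨⟨hp, hD⟩, hW⟩
      exact ⟨hp, fun h => (hp.dvd_mul.mp h).elim hW hD⟩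
    · rintro ⟨hp, hWD⟩
      exact ⟨⟨hp, fun h => hWD (dvd_mul_of_dvd_right h W)⟩,
        fun h => hWD (dvd_mul_of_dvd_left h D)⟩

/-- For `x ≥ W ≥ 1` the primes `p ≤ x` dividing `W` are exactly `W.primeFactors`. [folklore] -/
private theorem filter_range_prime_dvd_eq {W : ℕ} (hW : 0 < W) (D : ℕ) {x : ℕ} (hx : W ≤ x) :
    (Finset.range (x + 1)).filter (fun p => p.Prime ∧ p ∣ W ∧ ¬ p ∣ D)
      = W.primeFactors.filter (fun p => ¬ p ∣ D) := by
  ext p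
  simp only [Finset.mem_filter, Finset.mem_range, Nat.mem_primeFactors, ne_eq]
  constructor
  · rintro ⟨-, hp, hW', hD⟩
    exact ⟨⟨hp, hW', hW.ne'⟩, hD⟩
  · rintro ⟨⟨hp, hW', -⟩, hD⟩
    exact ⟨by have := Nat.le_of_dvd hW hW'; omega, hp, hW', hD⟩

/-- **Splitting past `x ≥ W`**: for `W ≥ 1` and `x ≥ W`,
`𝔖_D(𝓛; x) = (∏_{p ∣ W, p ∤ D} (1 − ω(p)/p)(1 − 1/p)^{-k}) · 𝔖_{WD}(𝓛; x)`.
[cite: FordGreenKonyaginMaynardTao2018, (7.6)–(7.7) p. 21] -/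
theorem singPartial_eq_primeFactors_prod_mul (L : Fin k → ℤ × ℤ) {W : ℕ} (hW : 0 < W) (D : ℕ)
    {x : ℕ} (hx : W ≤ x) :
    singPartial L D x =
      (∏ p ∈ W.primeFactors.filter (fun p => ¬ p ∣ D), singFactor L p)
        * singPartial L (W * D) x := by
  rw [singPartial_eq_prod_mul_singPartial_mul L W D x, filter_range_prime_dvd_eq hW D hx]

/-- **Splitting the singular series** (admissible non-degenerate family, `W ≥ 1`, any `D`):
`𝔖_D(𝓛) = (∏_{p ∣ W, p ∤ D} (1 − ω(p)/p)(1 − 1/p)^{-k}) · 𝔖_{WD}(𝓛)`.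
[cite: FordGreenKonyaginMaynardTao2018, (7.6)–(7.7) p. 21; Maynard2016DenseClusters, Lemma 8.1 p. 15] -/
theorem singSeriesExcl_eq_prod_mul_singSeriesExcl_mul {L : Fin k → ℤ × ℤ} (hadm : FormsAdmissible L)
    (hnd : FormsNondegenerate L) {W : ℕ} (hW : 0 < W) (D : ℕ) :
    singSeriesExcl L D =
      (∏ p ∈ W.primeFactors.filter (fun p => ¬ p ∣ D), singFactor L p)
        * singSeriesExcl L (W * D) := by
  have hT : Tendsto (singPartial L (W * D)) atTop (𝓝 (singSeriesExcl L (W * D))) :=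
    tendsto_singPartial_of_nondegenerate hadm hnd _
  have hT2 : Tendsto (singPartial L D) atTop
      (𝓝 ((∏ p ∈ W.primeFactors.filter (fun p => ¬ p ∣ D), singFactor L p)
        * singSeriesExcl L (W * D))) := by
    refine (hT.const_mul _).congr' ?_
    rw [Filter.EventuallyEq, Filter.eventually_atTop]
    exact ⟨W, fun x hx => (singPartial_eq_primeFactors_prod_mul L hW D hx).symm⟩
  exact hT2.limUnder_eq

/-- **Coprime case**: for `(W, D) = 1` (admissible non-degenerate family, `W ≥ 1`),
`𝔖_D(𝓛) = (∏_{p ∣ W} (1 − ω(p)/p)(1 − 1/p)^{-k}) · 𝔖_{WD}(𝓛)`; with `D = B` and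
`W = ∏_{p ≤ 2k², p ∤ B} p` this is the passage `𝔖_B ↔ 𝔖_{WB}` of the sieve normalisation.
[cite: FordGreenKonyaginMaynardTao2018, (7.6)–(7.8) p. 21; Maynard2016DenseClusters, proof of Prop. 6.1 p. 14] -/
theorem singSeriesExcl_eq_of_coprime {L : Fin k → ℤ × ℤ} (hadm : FormsAdmissible L)
    (hnd : FormsNondegenerate L) {W D : ℕ} (hW : 0 < W) (hcop : Nat.Coprime W D) :
    singSeriesExcl L D = (∏ p ∈ W.primeFactors, singFactor L p) * singSeriesExcl L (W * D) := by
  rw [singSeriesExcl_eq_prod_mul_singSeriesExcl_mul hadm hnd hW D,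
    Finset.filter_true_of_mem fun p hp => ?_]
  intro hD
  have hpr := Nat.prime_of_mem_primeFactors hp
  have h1 : p ∣ Nat.gcd W D := Nat.dvd_gcd (Nat.dvd_of_mem_primeFactors hp) hD
  rw [Nat.Coprime.gcd_eq_one hcop, Nat.dvd_one] at h1
  exact hpr.ne_one h1

/-- **Evaluation at a squarefree modulus**:
`∏_{p ∣ W} (1 − ω(p)/p)(1 − 1/p)^{-k} = φ_ω(W)/W · (W/φ(W))^k` for squarefree `W`
(`W = ∏_{p ∣ W} p`, `φ(W) = W ∏_{p ∣ W}(1 − 1/p)`, `φ_ω(W) = ∏_{p ∣ W}(p − ω(p))`).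
[cite: FordGreenKonyaginMaynardTao2018, (7.8) p. 21; Maynard2016DenseClusters, proof of Prop. 6.1 p. 14] -/
theorem prod_primeFactors_singFactor_eq (L : Fin k → ℤ × ℤ) {W : ℕ} (hW : Squarefree W) :
    ∏ p ∈ W.primeFactors, singFactor L p
      = phiOmega L W / W * ((W : ℝ) / Nat.totient W) ^ k := by
  have hW0 : (W : ℝ) ≠ 0 := by exact_mod_cast hW.ne_zero
  unfold singFactor phiOmega
  rw [Finset.prod_mul_distrib, Finset.prod_pow]
  congr 1
  · have hWprod : (W : ℝ) = ∏ p ∈ W.primeFactors, (p : ℝ) := by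
      have := congrArg (Nat.cast : ℕ → ℝ) (Nat.prod_primeFactors_of_squarefree hW)
      push_cast at this
      exact this.symm
    rw [eq_div_iff hW0, hWprod, ← Finset.prod_mul_distrib]
    refine Finset.prod_congr rfl fun p hp => ?_
    have hp0 : (p : ℝ) ≠ 0 := by exact_mod_cast (Nat.prime_of_mem_primeFactors hp).ne_zero
    field_simp
  · congr 1
    have hr : (Nat.totient W : ℝ) = W * ∏ p ∈ W.primeFactors, (1 - (p : ℝ)⁻¹) := by
      have := congrArg (fun q : ℚ => (q : ℝ)) (Nat.totient_eq_mul_prod_factors W)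
      push_cast at this
      exact this
    have hP : ∏ p ∈ W.primeFactors, (1 - (p : ℝ)⁻¹) ≠ 0 :=
      Finset.prod_ne_zero_iff.mpr fun p hp => by
        have hp1 : (1 : ℝ) < p := by exact_mod_cast (Nat.prime_of_mem_primeFactors hp).one_lt
        exact sub_ne_zero.mpr (inv_lt_one_of_one_lt₀ hp1).ne'
    simp_rw [one_div]
    rw [Finset.prod_inv_distrib, hr, div_mul_eq_div_div, div_self hW0, one_div]

/-- **`𝔖_D(𝓛) = φ_ω(W)/W · (W/φ(W))^k · 𝔖_{WD}(𝓛)`** for an admissible non-degenerate family,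
`W` squarefree and coprime to `D` — the identity converting the `𝔖_{WB}`-normalised sieve
weights into the `𝔖_B(𝓛)` of Theorem 6 / Prop. 6.1 after summing over the `φ_ω(W)` admissible
residue classes mod `W`.
[cite: FordGreenKonyaginMaynardTao2018, (7.6)–(7.8) p. 21; Maynard2016DenseClusters, proof of Prop. 6.1 p. 14] -/
theorem singSeriesExcl_eq_phiOmega_mul {L : Fin k → ℤ × ℤ} (hadm : FormsAdmissible L)
    (hnd : FormsNondegenerate L) {W D : ℕ} (hW : Squarefree W) (hcop : Nat.Coprime W D) :
    singSeriesExcl L D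
      = phiOmega L W / W * ((W : ℝ) / Nat.totient W) ^ k * singSeriesExcl L (W * D) := by
  rw [singSeriesExcl_eq_of_coprime hadm hnd (Nat.pos_of_ne_zero hW.ne_zero) hcop,
    prod_primeFactors_singFactor_eq L hW]

end Literature.NumberTheory.Sieve.FGKMT2018
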